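import Mathlib
import HarnessLib
import Summits.NavierStokesRegularity.NavierStokesRegularity.Theorems.PoloidalWindowDoorPoloidalWindowRigidityZShockHodographDarboux
import Summits.NavierStokesRegularity.NavierStokesRegularity.Theorems.PoloidalWindowDoorPoloidalWindowRigidityZShockHodographHump
import Summits.NavierStokesRegularity.NavierStokesRegularity.Theorems.PoloidalWindowDoorPoloidalWindowRigidityZShockHodographJacobian

/-!
# Crux K2 `PoloidalWindowRigidity` (stmt-NavierStokesRegularity-19708), line `z_shock` — NEGATIVE KERNEL BRICK 5a for the class-free
# slice Liouville `hGN`: HODOGRAPH DUALITY and SEGMENT DERIVATIVES of the hump two-wave map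

`--supports stmt-NavierStokesRegularity-19708 --as helper` (leafhand-ns-poloidalwindowdoor-3 g34, cell decomp-ns, 2026-09-01).
Class-free, def-free; Mathlib + bricks 1–3 (`…HodographDarboux` p842123, `…HodographHump` p842197, `…HodographJacobian` p842235).
**No stub and no summit is closed by this file; Navier–Stokes regularity is NOT proved here (rung 0).**  Evidence memo
`HGN-COUNTEREXAMPLE-leafhand3-g34.md` §3–§4.

* `hodograph_duality` — 2×2 linear algebra: if the Jacobian `M = ((τ_r, τ_s), (ξ_r, ξ_s))` of `(r,s) ↦ (τ,ξ)` satisfies the hodograph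
  system `ξ_s = k τ_s`, `ξ_r = −k τ_r` with `τ_r, τ_s ≠ 0`, then any left inverse `N = ((r_τ, r_ξ), (s_τ, s_ξ))` solves the p-system in
  Riemann invariants `r_τ + k r_ξ = 0`, `s_τ − k s_ξ = 0`, with `r_ξ = −1/(2kτ_r)`, `s_ξ = 1/(2kτ_s)` (gradient of the inverse bounded by
  the Jacobian floor of brick 2).
* `hasDerivAt_artanh_div`, `hasDerivAt_prim`, `hasDerivAt_psi` — the concrete one-variable derivatives of the hump data
  (`artanh(·/m)`, its log-primitive `F`, `ψ = 1 − ρ tanh ρ`).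
* `segment_hasDerivAt` — derivative of the Darboux pair along a segment `t ↦ (r₁ + tΔr, s₁ + tΔs)`: `τ' = Z_rΔr + Z_sΔs`,
  `ξ' = −ψ²Z_rΔr + ψ²Z_sΔs` (only the Darboux identities are used);  `segment_point` — the same for the concrete hump data at a
  point of the square, packaged with the signs `Z_r > 0`, `Z_s < 0`, `ψ > 0` from bricks 2–3.  Used by `…HodographInverse.hump_injective`.
[folklore]
-/

noncomputable section

namespace Summit.NavierStokesRegularity.NavierStokesRegularity.Theorems.PoloidalWindowDoorPoloidalWindowRigidityZShockHodographSegment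

-- the problem directory repeats the summit name (`NavierStokesRegularity/NavierStokesRegularity`)
set_option linter.dupNamespace false

open Real Set
open Summit.NavierStokesRegularity.NavierStokesRegularity.Theorems.PoloidalWindowDoorPoloidalWindowRigidityZShockHodographDarboux
open Summit.NavierStokesRegularity.NavierStokesRegularity.Theorems.PoloidalWindowDoorPoloidalWindowRigidityZShockHodographHump
open Summit.NavierStokesRegularity.NavierStokesRegularity.Theorems.PoloidalWindowDoorPoloidalWindowRigidityZShockHodographJacobian

/-- ★ **Hodograph duality.**  A left inverse of a hodograph Jacobian solves the p-system in Riemann invariants, with the explicit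
transversal derivatives `r_ξ = −1/(2kτ_r)`, `s_ξ = 1/(2kτ_s)` and `r_τ = 1/(2τ_r)`, `s_τ = 1/(2τ_s)`. [folklore] -/
theorem hodograph_duality (k τr τs ξr ξs rτ rξ sτ sξ : ℝ) (hk : k ≠ 0) (hτr : τr ≠ 0) (hτs : τs ≠ 0)
    (hξs : ξs = k * τs) (hξr : ξr = -k * τr)
    -- `N M = 1`
    (h11 : rτ * τr + rξ * ξr = 1) (h12 : rτ * τs + rξ * ξs = 0)
    (h21 : sτ * τr + sξ * ξr = 0) (h22 : sτ * τs + sξ * ξs = 1) :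
    rτ + k * rξ = 0 ∧ sτ - k * sξ = 0 ∧
      rξ = -1 / (2 * k * τr) ∧ sξ = 1 / (2 * k * τs) ∧ rτ = 1 / (2 * τr) ∧ sτ = 1 / (2 * τs) := by
  subst hξs hξr
  have e1 : rτ + k * rξ = 0 := by
    have : (rτ + k * rξ) * τs = 0 := by linear_combination h12
    exact (mul_eq_zero.mp this).resolve_right hτs
  have e2 : sτ - k * sξ = 0 := by
    have : (sτ - k * sξ) * τr = 0 := by linear_combination h21
    exact (mul_eq_zero.mp this).resolve_right hτr
  refine ⟨e1, e2, ?_, ?_, ?_, ?_⟩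
  · have h2 : 2 * k * τr ≠ 0 := by positivity
    rw [eq_div_iff h2]
    linear_combination (-1 : ℝ) * h11 + τr * e1
  · have h2 : 2 * k * τs ≠ 0 := by positivity
    rw [eq_div_iff h2]
    linear_combination h22 - τs * e2
  · have h2 : 2 * τr ≠ 0 := by positivity
    rw [eq_div_iff h2]
    linear_combination h11 + τr * e1
  · have h2 : 2 * τs ≠ 0 := by positivity
    rw [eq_div_iff h2]
    linear_combination h22 + τs * e2

/-! ### Concrete one-variable derivatives of the hump data -/

/-- `d/dt artanh(t/m) = (1/m)/(1 − (t/m)²)` for `|t| < m`. [folklore] -/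
theorem hasDerivAt_artanh_div (m t : ℝ) (hm : 0 < m) (ht : |t| < m) :
    HasDerivAt (fun t => Real.artanh (t / m)) (1 / m / (1 - (t / m) ^ 2)) t := by
  have htabs := abs_lt.mp ht
  have hx1 : t / m < 1 := by rw [div_lt_one hm]; linarith
  have hx0 : -1 < t / m := by rw [lt_div_iff₀ hm]; linarith
  have ha : 0 < 1 + t / m := by linarith
  have hb : 0 < 1 - t / m := by linarith
  -- near `t`, `artanh (t'/m) = ½ (log(1 + t'/m) − log(1 − t'/m))`
  have hev : (fun t' => Real.artanh (t' / m)) =ᶠ[nhds t]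
      fun t' => 1 / 2 * (Real.log (1 + t' / m) - Real.log (1 - t' / m)) := by
    have hIoo : Set.Ioo (-m) m ∈ nhds t := isOpen_Ioo.mem_nhds ⟨htabs.1, htabs.2⟩
    filter_upwards [hIoo] with t' ht'
    have h1' : t' / m < 1 := by rw [div_lt_one hm]; exact ht'.2
    have h0' : -1 < t' / m := by rw [lt_div_iff₀ hm]; linarith [ht'.1]
    rw [Real.artanh_eq_half_log ⟨h0'.le, h1'.le⟩, Real.log_div (by linarith) (by linarith)]
  refine HasDerivAt.congr_of_eventuallyEq ?_ hev
  have hu : HasDerivAt (fun t' : ℝ => 1 + t' / m) (1 / m) t := by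
    simpa using ((hasDerivAt_id' t).div_const m).const_add 1
  have hv : HasDerivAt (fun t' : ℝ => 1 - t' / m) (-(1 / m)) t := by
    simpa using ((hasDerivAt_id' t).div_const m).const_sub 1
  have h1 : HasDerivAt (fun t' => Real.log (1 + t' / m)) ((1 / m) / (1 + t / m)) t := hu.log ha.ne'
  have h2 : HasDerivAt (fun t' => Real.log (1 - t' / m)) ((-(1 / m)) / (1 - t / m)) t := hv.log hb.ne'
  have h := (h1.sub h2).const_mul (1 / 2)
  refine h.congr_deriv ?_
  have hmt : m + t ≠ 0 := by
    have : 0 < m + t := by linarith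
    exact this.ne'
  have hmt' : m - t ≠ 0 := by
    have : 0 < m - t := by linarith
    exact this.ne'
  have hm2t2 : m ^ 2 - t ^ 2 ≠ 0 := by
    have : m ^ 2 - t ^ 2 = (m + t) * (m - t) := by ring
    rw [this]; exact mul_ne_zero hmt hmt'
  have ha' := ha.ne'
  have hb' := hb.ne'
  have hc : 1 - (t / m) ^ 2 ≠ 0 := by
    have : 1 - (t / m) ^ 2 = (1 + t / m) * (1 - t / m) := by ring
    rw [this]; exact mul_ne_zero ha' hb'
  field_simp
  ring

/-- `d/dt F(t) = artanh(t/m)` for the primitive `F(t) = (m/2)[(1+t/m)log(1+t/m) + (1−t/m)log(1−t/m)]`, `|t| < m`. [folklore] -/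
theorem hasDerivAt_prim (m t : ℝ) (hm : 0 < m) (ht : |t| < m) :
    HasDerivAt (fun t => m / 2 * ((1 + t / m) * Real.log (1 + t / m) + (1 - t / m) * Real.log (1 - t / m)))
      (Real.artanh (t / m)) t := by
  have htabs := abs_lt.mp ht
  have hx1 : t / m < 1 := by rw [div_lt_one hm]; linarith
  have hx0 : -1 < t / m := by rw [lt_div_iff₀ hm]; linarith
  have ha : 0 < 1 + t / m := by linarith
  have hb : 0 < 1 - t / m := by linarith
  have hu : HasDerivAt (fun t' : ℝ => 1 + t' / m) (1 / m) t := by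
    simpa using ((hasDerivAt_id' t).div_const m).const_add 1
  have hv : HasDerivAt (fun t' : ℝ => 1 - t' / m) (-(1 / m)) t := by
    simpa using ((hasDerivAt_id' t).div_const m).const_sub 1
  have h1 : HasDerivAt (fun t' => (1 + t' / m) * Real.log (1 + t' / m))
      (1 / m * Real.log (1 + t / m) + (1 + t / m) * ((1 / m) / (1 + t / m))) t := hu.mul (hu.log ha.ne')
  have h2 : HasDerivAt (fun t' => (1 - t' / m) * Real.log (1 - t' / m))
      (-(1 / m) * Real.log (1 - t / m) + (1 - t / m) * ((-(1 / m)) / (1 - t / m))) t := hv.mul (hv.log hb.ne')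
  have h := (h1.add h2).const_mul (m / 2)
  refine h.congr_deriv ?_
  rw [Real.artanh_eq_half_log ⟨hx0.le, hx1.le⟩, Real.log_div ha.ne' hb.ne']
  set L1 := Real.log (1 + t / m)
  set L2 := Real.log (1 - t / m)
  have ha' := ha.ne'
  have hb' := hb.ne'
  have hmt : m + t ≠ 0 := by
    have : 0 < m + t := by linarith
    exact this.ne'
  have hmt' : m - t ≠ 0 := by
    have : 0 < m - t := by linarith
    exact this.ne'
  have e1 : (1 + t / m) * ((1 / m) / (1 + t / m)) = 1 / m := by field_simp
  have e2 : (1 - t / m) * ((-(1 / m)) / (1 - t / m)) = -(1 / m) := by field_simp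
  rw [e1, e2]
  field_simp
  ring

/-- `d/dρ (1 − ρ tanh ρ) = −(tanh ρ + ρ(1 − tanh²ρ))`. [folklore] -/
theorem hasDerivAt_psi (ρ : ℝ) :
    HasDerivAt (fun ρ => 1 - ρ * Real.tanh ρ) (-(Real.tanh ρ + ρ * (1 - Real.tanh ρ ^ 2))) ρ := by
  have hT := hasDerivAt_tanh_one_sub_sq ρ
  have h := ((hasDerivAt_id' ρ).mul hT).const_sub 1
  refine h.congr_deriv ?_
  ring

/-! ### Derivatives along a segment of the square (both `r` and `s` moving) -/

/-- **Segment derivative of the Darboux pair (`α = 0`, `β = −1`).**  Along `t' ↦ (r₁ + t'Δr, s₁ + t'Δs)` the pair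
`τ = [f(r) − f(s) − T(ρ)(F(r)+F(s))]/ψ(ρ)`, `ξ = −ψ(ρ)(f(r)+f(s)) − ρ(F(r) − F(s)) + 𝔽(r) + 𝔽(s)` (`ρ = (r−s)/2`) has
`t`-derivatives `Z_r Δr + Z_s Δs` and `−ψ² Z_r Δr + ψ² Z_s Δs`, where `Z_r`, `Z_s` are the values recorded by
`…HodographDarboux.hodograph_r/_s`; only the Darboux identities (I1) `ψT + ψ' = −ρ`, (I2) `ψT' − ψ'T = 1` at `ρ` are used. [folklore] -/
theorem segment_hasDerivAt (f F 𝔽 T ψ : ℝ → ℝ) (r₁ s₁ Δr Δs t r s fr₁ fs₁ T₁ ψ₁ : ℝ)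
    (hr : r₁ + t * Δr = r) (hs : s₁ + t * Δs = s)
    (hfr : HasDerivAt f fr₁ r) (hfs : HasDerivAt f fs₁ s)
    (hFr : HasDerivAt F (f r) r) (hFs : HasDerivAt F (f s) s)
    (h𝔽r : HasDerivAt 𝔽 (F r) r) (h𝔽s : HasDerivAt 𝔽 (F s) s)
    (hT : HasDerivAt T T₁ ((r - s) / 2)) (hψ : HasDerivAt ψ ψ₁ ((r - s) / 2))
    (hψ0 : ψ ((r - s) / 2) ≠ 0)
    (hI1 : ψ ((r - s) / 2) * T ((r - s) / 2) + ψ₁ = -((r - s) / 2))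
    (hI2 : ψ ((r - s) / 2) * T₁ - ψ₁ * T ((r - s) / 2) = 1) :
    HasDerivAt (fun t' => (f (r₁ + t' * Δr) - f (s₁ + t' * Δs) -
        T (((r₁ + t' * Δr) - (s₁ + t' * Δs)) / 2) * (F (r₁ + t' * Δr) + F (s₁ + t' * Δs))) /
        ψ (((r₁ + t' * Δr) - (s₁ + t' * Δs)) / 2))
      ((((fr₁ - (T₁ * (1 / 2) * (F r + F s) + T ((r - s) / 2) * f r)) * ψ ((r - s) / 2) -
            (f r - f s - T ((r - s) / 2) * (F r + F s)) * (ψ₁ * (1 / 2))) / ψ ((r - s) / 2) ^ 2) * Δr +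
        (((-fs₁ - (T₁ * (-(1 / 2)) * (F r + F s) + T ((r - s) / 2) * f s)) * ψ ((r - s) / 2) -
            (f r - f s - T ((r - s) / 2) * (F r + F s)) * (ψ₁ * (-(1 / 2)))) / ψ ((r - s) / 2) ^ 2) * Δs) t ∧
    HasDerivAt (fun t' => -ψ (((r₁ + t' * Δr) - (s₁ + t' * Δs)) / 2) * (f (r₁ + t' * Δr) + f (s₁ + t' * Δs)) -
        ((r₁ + t' * Δr) - (s₁ + t' * Δs)) / 2 * (F (r₁ + t' * Δr) - F (s₁ + t' * Δs)) +
        (𝔽 (r₁ + t' * Δr) + 𝔽 (s₁ + t' * Δs)))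
      (-(ψ ((r - s) / 2)) ^ 2 *
          ((((fr₁ - (T₁ * (1 / 2) * (F r + F s) + T ((r - s) / 2) * f r)) * ψ ((r - s) / 2) -
            (f r - f s - T ((r - s) / 2) * (F r + F s)) * (ψ₁ * (1 / 2))) / ψ ((r - s) / 2) ^ 2)) * Δr +
        (ψ ((r - s) / 2)) ^ 2 *
          ((((-fs₁ - (T₁ * (-(1 / 2)) * (F r + F s) + T ((r - s) / 2) * f s)) * ψ ((r - s) / 2) -
            (f r - f s - T ((r - s) / 2) * (F r + F s)) * (ψ₁ * (-(1 / 2)))) / ψ ((r - s) / 2) ^ 2)) * Δs) t := by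
  subst hr hs
  -- the moving coordinates
  have hR : HasDerivAt (fun t' : ℝ => r₁ + t' * Δr) Δr t := by
    simpa using ((hasDerivAt_id' t).mul_const Δr).const_add r₁
  have hS : HasDerivAt (fun t' : ℝ => s₁ + t' * Δs) Δs t := by
    simpa using ((hasDerivAt_id' t).mul_const Δs).const_add s₁
  have hρ : HasDerivAt (fun t' : ℝ => ((r₁ + t' * Δr) - (s₁ + t' * Δs)) / 2) ((Δr - Δs) / 2) t :=
    (hR.sub hS).div_const 2
  have hfR : HasDerivAt (fun t' => f (r₁ + t' * Δr)) (fr₁ * Δr) t := hfr.comp t hR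
  have hfS : HasDerivAt (fun t' => f (s₁ + t' * Δs)) (fs₁ * Δs) t := hfs.comp t hS
  have hFR : HasDerivAt (fun t' => F (r₁ + t' * Δr)) (f (r₁ + t * Δr) * Δr) t := hFr.comp t hR
  have hFS : HasDerivAt (fun t' => F (s₁ + t' * Δs)) (f (s₁ + t * Δs) * Δs) t := hFs.comp t hS
  have h𝔽R : HasDerivAt (fun t' => 𝔽 (r₁ + t' * Δr)) (F (r₁ + t * Δr) * Δr) t := h𝔽r.comp t hR
  have h𝔽S : HasDerivAt (fun t' => 𝔽 (s₁ + t' * Δs)) (F (s₁ + t * Δs) * Δs) t := h𝔽s.comp t hS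
  have hTc : HasDerivAt (fun t' => T (((r₁ + t' * Δr) - (s₁ + t' * Δs)) / 2)) (T₁ * ((Δr - Δs) / 2)) t :=
    hT.comp t hρ
  have hψc : HasDerivAt (fun t' => ψ (((r₁ + t' * Δr) - (s₁ + t' * Δs)) / 2)) (ψ₁ * ((Δr - Δs) / 2)) t :=
    hψ.comp t hρ
  have hu : HasDerivAt (fun t' => f (r₁ + t' * Δr) - f (s₁ + t' * Δs) -
      T (((r₁ + t' * Δr) - (s₁ + t' * Δs)) / 2) * (F (r₁ + t' * Δr) + F (s₁ + t' * Δs)))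
      (fr₁ * Δr - fs₁ * Δs - (T₁ * ((Δr - Δs) / 2) * (F (r₁ + t * Δr) + F (s₁ + t * Δs)) +
        T (((r₁ + t * Δr) - (s₁ + t * Δs)) / 2) * (f (r₁ + t * Δr) * Δr + f (s₁ + t * Δs) * Δs))) t :=
    (hfR.sub hfS).sub (hTc.mul (hFR.add hFS))
  constructor
  · have hz := hu.div hψc hψ0
    refine hz.congr_deriv ?_
    field_simp
    ring
  · have hx : HasDerivAt (fun t' => -ψ (((r₁ + t' * Δr) - (s₁ + t' * Δs)) / 2) *
        (f (r₁ + t' * Δr) + f (s₁ + t' * Δs)) -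
        ((r₁ + t' * Δr) - (s₁ + t' * Δs)) / 2 * (F (r₁ + t' * Δr) - F (s₁ + t' * Δs)) +
        (𝔽 (r₁ + t' * Δr) + 𝔽 (s₁ + t' * Δs)))
        (-(ψ₁ * ((Δr - Δs) / 2)) * (f (r₁ + t * Δr) + f (s₁ + t * Δs)) +
            -ψ (((r₁ + t * Δr) - (s₁ + t * Δs)) / 2) * (fr₁ * Δr + fs₁ * Δs) -
          ((Δr - Δs) / 2 * (F (r₁ + t * Δr) - F (s₁ + t * Δs)) +
            ((r₁ + t * Δr) - (s₁ + t * Δs)) / 2 * (f (r₁ + t * Δr) * Δr - f (s₁ + t * Δs) * Δs)) +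
          (F (r₁ + t * Δr) * Δr + F (s₁ + t * Δs) * Δs)) t :=
      ((hψc.neg.mul (hfR.add hfS)).sub (hρ.mul (hFR.sub hFS))).add (h𝔽R.add h𝔽S)
    refine hx.congr_deriv ?_
    set ψv : ℝ := ψ (((r₁ + t * Δr) - (s₁ + t * Δs)) / 2) with hψv
    set Tv : ℝ := T (((r₁ + t * Δr) - (s₁ + t * Δs)) / 2) with hTv
    set fr : ℝ := f (r₁ + t * Δr) with hfrv
    set fs : ℝ := f (s₁ + t * Δs) with hfsv
    set Fr : ℝ := F (r₁ + t * Δr) with hFrv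
    set Fs : ℝ := F (s₁ + t * Δs) with hFsv
    have hψ2 : ψv ^ 2 ≠ 0 := pow_ne_zero 2 hψ0
    have e1 : -ψv ^ 2 *
        (((fr₁ - (T₁ * (1 / 2) * (Fr + Fs) + Tv * fr)) * ψv - (fr - fs - Tv * (Fr + Fs)) * (ψ₁ * (1 / 2))) / ψv ^ 2) =
        -(((fr₁ - (T₁ * (1 / 2) * (Fr + Fs) + Tv * fr)) * ψv - (fr - fs - Tv * (Fr + Fs)) * (ψ₁ * (1 / 2)))) := by
      field_simp
    have e2 : ψv ^ 2 *
        (((-fs₁ - (T₁ * (-(1 / 2)) * (Fr + Fs) + Tv * fs)) * ψv - (fr - fs - Tv * (Fr + Fs)) * (ψ₁ * (-(1 / 2)))) /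
          ψv ^ 2) =
        ((-fs₁ - (T₁ * (-(1 / 2)) * (Fr + Fs) + Tv * fs)) * ψv - (fr - fs - Tv * (Fr + Fs)) * (ψ₁ * (-(1 / 2)))) := by
      field_simp
    rw [e1, e2]
    linear_combination (-fr * Δr + fs * Δs) * hI1 - (1 / 2) * (Fr + Fs) * (Δr + Δs) * hI2

/-! ### Global injectivity of the hump two-wave map -/

/-- Convex-combination bound: points of the segment between two points of `(−m, m)` stay in `(−m, m)`. [folklore] -/
theorem abs_segment_lt {m a b t : ℝ} (ha : |a| < m) (hb : |b| < m) (ht0 : 0 ≤ t) (ht1 : t ≤ 1) :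
    |a + t * (b - a)| < m := by
  have ha' := abs_lt.mp ha
  have hb' := abs_lt.mp hb
  rw [abs_lt]
  rcases le_total a b with hab | hab
  · constructor
    · nlinarith [mul_nonneg ht0 (sub_nonneg.mpr hab)]
    · nlinarith [mul_nonneg (sub_nonneg.mpr ht1) (sub_nonneg.mpr hab)]
  · constructor
    · nlinarith [mul_nonneg (sub_nonneg.mpr ht1) (sub_nonneg.mpr hab)]
    · nlinarith [mul_nonneg ht0 (sub_nonneg.mpr hab)]

/-- **Derivatives along a segment at one point, with signs** (the concrete hump data; `𝔽` any primitive of `F`):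
there are numbers `Z_r > 0`, `Z_s < 0`, `ψ > 0` with `(τ∘γ)' = Z_rΔr + Z_sΔs` and `(ξ∘γ)' = −ψ²Z_rΔr + ψ²Z_sΔs` at `t`,
`γ(t') = (r₁ + t'Δr, s₁ + t'Δs)`. [folklore] -/
theorem segment_point (m : ℝ) (hm : 0 < m) (hm' : m ≤ 1 / 2) (𝔽 : ℝ → ℝ)
    (h𝔽 : ∀ t, |t| < m → HasDerivAt 𝔽
      (m / 2 * ((1 + t / m) * Real.log (1 + t / m) + (1 - t / m) * Real.log (1 - t / m))) t)
    (r₁ s₁ Δr Δs t : ℝ) (hr : |r₁ + t * Δr| < m) (hs : |s₁ + t * Δs| < m) :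
    ∃ Zr Zs ψv : ℝ, 0 < Zr ∧ Zs < 0 ∧ 0 < ψv ∧
      HasDerivAt (fun t' => (Real.artanh ((r₁ + t' * Δr) / m) - Real.artanh ((s₁ + t' * Δs) / m) -
          Real.tanh (((r₁ + t' * Δr) - (s₁ + t' * Δs)) / 2) *
            (m / 2 * ((1 + (r₁ + t' * Δr) / m) * Real.log (1 + (r₁ + t' * Δr) / m) +
                (1 - (r₁ + t' * Δr) / m) * Real.log (1 - (r₁ + t' * Δr) / m)) +
              m / 2 * ((1 + (s₁ + t' * Δs) / m) * Real.log (1 + (s₁ + t' * Δs) / m) +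
                (1 - (s₁ + t' * Δs) / m) * Real.log (1 - (s₁ + t' * Δs) / m)))) /
          (1 - ((r₁ + t' * Δr) - (s₁ + t' * Δs)) / 2 * Real.tanh (((r₁ + t' * Δr) - (s₁ + t' * Δs)) / 2)))
        (Zr * Δr + Zs * Δs) t ∧
      HasDerivAt (fun t' => -(1 - ((r₁ + t' * Δr) - (s₁ + t' * Δs)) / 2 *
            Real.tanh (((r₁ + t' * Δr) - (s₁ + t' * Δs)) / 2)) *
          (Real.artanh ((r₁ + t' * Δr) / m) + Real.artanh ((s₁ + t' * Δs) / m)) -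
          ((r₁ + t' * Δr) - (s₁ + t' * Δs)) / 2 *
            (m / 2 * ((1 + (r₁ + t' * Δr) / m) * Real.log (1 + (r₁ + t' * Δr) / m) +
                (1 - (r₁ + t' * Δr) / m) * Real.log (1 - (r₁ + t' * Δr) / m)) -
              m / 2 * ((1 + (s₁ + t' * Δs) / m) * Real.log (1 + (s₁ + t' * Δs) / m) +
                (1 - (s₁ + t' * Δs) / m) * Real.log (1 - (s₁ + t' * Δs) / m))) +
          (𝔽 (r₁ + t' * Δr) + 𝔽 (s₁ + t' * Δs)))
        (-ψv ^ 2 * Zr * Δr + ψv ^ 2 * Zs * Δs) t := by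
  set r : ℝ := r₁ + t * Δr with hrdef
  set sv : ℝ := s₁ + t * Δs with hsdef
  have hseg := segment_hasDerivAt (fun x => Real.artanh (x / m))
    (fun x => m / 2 * ((1 + x / m) * Real.log (1 + x / m) + (1 - x / m) * Real.log (1 - x / m))) 𝔽 Real.tanh
    (fun ρ => 1 - ρ * Real.tanh ρ) r₁ s₁ Δr Δs t r sv (1 / m / (1 - (r / m) ^ 2)) (1 / m / (1 - (sv / m) ^ 2))
    (1 - Real.tanh ((r - sv) / 2) ^ 2) (-(Real.tanh ((r - sv) / 2) + (r - sv) / 2 * (1 - Real.tanh ((r - sv) / 2) ^ 2)))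
    hrdef.symm hsdef.symm (hasDerivAt_artanh_div m r hm hr) (hasDerivAt_artanh_div m sv hm hs)
    (hasDerivAt_prim m r hm hr) (hasDerivAt_prim m sv hm hs) (h𝔽 r hr) (h𝔽 sv hs)
    (hasDerivAt_tanh_one_sub_sq _) (hasDerivAt_psi _) ?_ (by ring) (by ring)
  swap
  · -- ψ ≠ 0
    have hρm : |(r - sv) / 2| < m := by
      have h1 := abs_lt.mp hr; have h2 := abs_lt.mp hs
      rw [abs_lt]; constructor <;> linarith
    have ht' : |Real.tanh ((r - sv) / 2)| ≤ |(r - sv) / 2| :=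
      Literature.Barriers.HubbardSuperconductivity.abs_tanh_le_abs_self _
    have h1 : (r - sv) / 2 * Real.tanh ((r - sv) / 2) ≤ |(r - sv) / 2| * |Real.tanh ((r - sv) / 2)| := by
      rw [← abs_mul]; exact le_abs_self _
    have h2 : |(r - sv) / 2| * |Real.tanh ((r - sv) / 2)| ≤ |(r - sv) / 2| * |(r - sv) / 2| :=
      mul_le_mul_of_nonneg_left ht' (abs_nonneg _)
    have h3 : |(r - sv) / 2| * |(r - sv) / 2| < m * m := mul_self_lt_mul_self (abs_nonneg _) hρm
    nlinarith
  obtain ⟨hτ, hξ⟩ := hseg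
  have hZr := hump_tau_r_pos m r sv hm hm' hr hs
  have hZs := hump_tau_s_neg m r sv hm hm' hr hs
  refine ⟨_, _, 1 - (r - sv) / 2 * Real.tanh ((r - sv) / 2), hZr, hZs, ?_, hτ, ?_⟩
  · have hρm : |(r - sv) / 2| < m := by
      have h1 := abs_lt.mp hr; have h2 := abs_lt.mp hs
      rw [abs_lt]; constructor <;> linarith
    have ht' : |Real.tanh ((r - sv) / 2)| ≤ |(r - sv) / 2| :=
      Literature.Barriers.HubbardSuperconductivity.abs_tanh_le_abs_self _
    have h1 : (r - sv) / 2 * Real.tanh ((r - sv) / 2) ≤ |(r - sv) / 2| * |Real.tanh ((r - sv) / 2)| := by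
      rw [← abs_mul]; exact le_abs_self _
    have h2 : |(r - sv) / 2| * |Real.tanh ((r - sv) / 2)| ≤ |(r - sv) / 2| * |(r - sv) / 2| :=
      mul_le_mul_of_nonneg_left ht' (abs_nonneg _)
    have h3 : |(r - sv) / 2| * |(r - sv) / 2| < m * m := mul_self_lt_mul_self (abs_nonneg _) hρm
    nlinarith
  · convert hξ using 1

end Summit.NavierStokesRegularity.NavierStokesRegularity.Theorems.PoloidalWindowDoorPoloidalWindowRigidityZShockHodographSegment
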